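import Summits.Parity.GeneralizedHardyLittlewood.Theorems.LeeYangFibresRelativeDimOneFloatingDefs
import Summits.Parity.GeneralizedHardyLittlewood.Theorems.LeeYangFibresRelativeDimOneFloatingLinnikCharPNT
import Summits.Parity.GeneralizedHardyLittlewood.Theorems.LeeYangFibresRelativeDimOneGRHCalibration
import HarnessLib

/-!
# Route `LeeYangFibres`, crux `RelativeDimOne` (stmt-Parity-14113), line `floating-level-core` (lead seat a1):
# stub (A) `stub_flatSecondMoment` — the class second moment in LINNIK'S RANGE from the no-Siegel-zero region

Registered stub of the checked skeleton `Cruxes/RelativeDimOne/Lines/floating_level_core.lean`: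

  `stub_flatSecondMoment : NoSiegelZeros → LowClassSecondMomentFlat`,

`LowClassSecondMomentFlat := ∀ ε > 0 ∃ θ₁ > 0 ∃ N₀ ∀ N ≥ N₀ ∀ 1 ≤ q ≤ N^{θ₁}: Σ_{a mod q} ψ(N;q,a)² ≤ (1+ε)(N²/φ(q) + N log N)`
(vocabulary `Theorems/LeeYangFibresRelativeDimOneFloatingDefs.lean`). This is where the FLOATING LEVEL buys a theorem:
at a fixed power level `θ₁` the class second moment with constant `1 + ε` for every `ε` is quasi-GRH-hard (it killed
the line `gallagher-backwards-split`), but with the level chosen AFTER the accuracy it is Gallagher's prime number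
theorem in Linnik's range plus rh.S34.

## Proof

INPUT (tool file `…FloatingLinnikCharPNT.lean`, PROVED from the tree's unconditional Gallagher theorem with adjustable
threshold `gallagher_nonexceptional_threshold` and Page's theorem): under `NoSiegelZeros` there are `c, θ₀, K > 0` with
`Σ_{χ mod q} ‖Σ_{p ≤ N} χ⋆(p) log p − [χ = χ₀]N‖ ≤ K e^{−c/θ₁} N` for `0 < θ₁ ≤ θ₀`, `N ≥ N₀(θ₁)`, `q ≤ N^{θ₁}`
(`linnikCharSum_of_noSiegelZeros`). For `χ ≠ χ₀ mod q` the passage `ψ(N,χ) ↝ Σ_{p ≤ N} χ⋆(p) log p` costs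
`≤ log q` (primes dividing `q`, `PrimesInAPGallagher.norm_sub_charPrimeSum_le`) `+ (ψ(N) − ϑ(N)) ≤ 2√N log N` (prime
powers), so `T := Σ_{χ ≠ χ₀} ‖ψ(N,χ)‖ ≤ K e^{−c/θ₁} N + φ(q)·3√N log N`. Choose `θ₁ = θ₁(ε) ≤ min(θ₀, 1/4)` with
`K e^{−c/θ₁} ≤ √ε/4`; since `φ(q) ≤ N^{1/4}`, eventually `T ≤ (√ε/2) N`, hence `Σ_{χ ≠ χ₀} ‖ψ(N,χ)‖² ≤ T² ≤ (ε/4)N²`.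
Parseval on `(ℤ/qℤ)ˣ` (`GRHCalibration.totient_mul_sum_coprime_sq`): `φ(q) Σ_{(a,q)=1} ψ(N;q,a)² = Σ_χ ‖ψ(N,χ)‖²
≤ ψ(N)² + T² ≤ (1 + ε/2)N² + (ε/4)N²` (PNT, `eventually_psi_le`); the non-coprime classes give
`φ(q) · 9N log²N ≤ (ε/4)N²` (`sum_not_coprime_sq_le`, `φ(q) ≤ N^{1/4}`). Total `≤ (1+ε) N²/φ(q)`. The level enters
ONLY through `e^{−c/θ₁}`.

References: Gallagher, Invent. Math. 11 (1970), Theorem 7 [Gallagher1970]; Montgomery–Vaughan, Acta Arith. 27 (1975)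
§4 [MontgomeryVaughanActa1975]; Davenport, *Multiplicative Number Theory*, ch. 14, 20 [DavenportMNT1980].
-/

noncomputable section

open scoped BigOperators ArithmeticFunction.vonMangoldt
open Finset Filter
open Literature.NumberTheory.Sieve Literature.NumberTheory.Sieve.MontgomeryVaughan1975
open Summit.Parity.GeneralizedHardyLittlewood.Cruxes.RelativeDimOne.GallagherBackwards
open Summit.Parity.GeneralizedHardyLittlewood.Cruxes.RelativeDimOne.GallagherBackwards.GRHCalibration
open Summit.Parity.GeneralizedHardyLittlewood.Cruxes.RelativeDimOne.GallagherBackwardsSplit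
open Summit.Parity.GeneralizedHardyLittlewood.Cruxes.RelativeDimOne.TypeSplit
open Summit.Parity.GeneralizedHardyLittlewood.Cruxes.RelativeDimOne.TypeSplit.GRHCalibration

namespace Summit.Parity.GeneralizedHardyLittlewood.Cruxes.RelativeDimOne.FloatingLevelCore

/-! ### From `ψ(N, χ)` to Gallagher's term of the primitive inducer -/

/-- For `χ ≠ χ₀ mod q`: `‖ψ(N,χ)‖ ≤ ‖Σ_{p ≤ N} χ⋆(p) log p‖ + log q + 2√N log N` — the prime powers cost
`ψ(N) − ϑ(N) ≤ 2√N log N`, the primes dividing `q` (where `χ = 0 ≠ χ⋆`) cost `≤ log q`, and for `χ ≠ χ₀` the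
Gallagher term `∑#` of `χ⋆` (conductor `≠ 1`) is the plain prime sum. -/
theorem norm_charPsi_le_gallagherTerm {q : ℕ} [NeZero q] (χ : DirichletCharacter ℂ q) (hχ : χ ≠ 1)
    {N : ℕ} (hN : 1 ≤ N) :
    ‖charPsi χ N‖ ≤ ‖gallagherTerm χ.primitiveCharacter N N‖ + Real.log q +
      2 * Real.sqrt N * Real.log N := by
  classical
  have hcond : χ.conductor ≠ 1 := fun h => hχ (DirichletCharacter.eq_one_iff_conductor_eq_one.mpr h)
  have hgt : gallagherTerm χ.primitiveCharacter N N = charPrimeSum χ.primitiveCharacter N N := by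
    rw [gallagherTerm, if_neg hcond, sub_zero]
  unfold charPsi
  rw [← sum_filter_add_sum_filter_not (Icc 1 N) Nat.Prime]
  refine (norm_add_le _ _).trans ?_
  have hprime : ‖∑ n ∈ (Icc 1 N).filter Nat.Prime, (Λ n : ℂ) * χ (n : ZMod q)‖ ≤
      ‖gallagherTerm χ.primitiveCharacter N N‖ + Real.log q := by
    have heq : ∑ n ∈ (Icc 1 N).filter Nat.Prime, (Λ n : ℂ) * χ (n : ZMod q) =
        ∑ p ∈ (Ioc 0 N).filter Nat.Prime, χ (p : ZMod q) * (Real.log p : ℂ) := by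
      have hI : Icc 1 N = Ioc 0 N := by
        ext n
        simp only [mem_Icc, mem_Ioc]
        omega
      rw [hI]
      refine sum_congr rfl fun p hp => ?_
      rw [ArithmeticFunction.vonMangoldt_apply_prime (mem_filter.1 hp).2, mul_comm]
    rw [heq, hgt]
    have h := PrimesInAPGallagher.norm_sub_charPrimeSum_le χ N
    have h2 := norm_le_insert' (∑ p ∈ (Ioc 0 N).filter Nat.Prime, χ (p : ZMod q) * (Real.log p : ℂ))
      (charPrimeSum χ.primitiveCharacter N N)
    linarith
  have hpow : ‖∑ n ∈ (Icc 1 N).filter (fun n => ¬ n.Prime), (Λ n : ℂ) * χ (n : ZMod q)‖ ≤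
      2 * Real.sqrt N * Real.log N := by
    calc ‖∑ n ∈ (Icc 1 N).filter (fun n => ¬ n.Prime), (Λ n : ℂ) * χ (n : ZMod q)‖
        ≤ ∑ n ∈ (Icc 1 N).filter (fun n => ¬ n.Prime), ‖(Λ n : ℂ) * χ (n : ZMod q)‖ := norm_sum_le _ _
      _ ≤ ∑ n ∈ (Icc 1 N).filter (fun n => ¬ n.Prime), Λ n := by
          refine sum_le_sum fun n _ => ?_
          rw [norm_mul, Complex.norm_real, Real.norm_of_nonneg ArithmeticFunction.vonMangoldt_nonneg]
          calc Λ n * ‖χ (n : ZMod q)‖ ≤ Λ n * 1 :=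
                mul_le_mul_of_nonneg_left (DirichletCharacter.norm_le_one χ _)
                  ArithmeticFunction.vonMangoldt_nonneg
            _ = Λ n := mul_one _
      _ = Chebyshev.psi N - Chebyshev.theta N := sum_not_prime_vonMangoldt N
      _ ≤ 2 * Real.sqrt N * Real.log N := Chebyshev.psi_sub_theta_le (by exact_mod_cast hN)
  linarith

/-- Summed over the non-principal characters mod `q` (`1 ≤ N`):
`Σ_{χ ≠ χ₀} ‖ψ(N,χ)‖ ≤ Σ_{χ mod q} ‖∑# χ⋆‖ + φ(q) (log q + 2√N log N)`. -/
theorem sum_norm_charPsi_le {q : ℕ} [NeZero q] {N : ℕ} (hN : 1 ≤ N) :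
    ∑ χ ∈ (univ : Finset (DirichletCharacter ℂ q)).erase 1, ‖charPsi χ N‖ ≤
      ∑ χ : DirichletCharacter ℂ q, ‖gallagherTerm χ.primitiveCharacter N N‖ +
        (q.totient : ℝ) * (Real.log q + 2 * Real.sqrt N * Real.log N) := by
  classical
  have hcard : ((univ : Finset (DirichletCharacter ℂ q)).erase 1).card ≤ q.totient := by
    calc ((univ : Finset (DirichletCharacter ℂ q)).erase 1).card
        ≤ (univ : Finset (DirichletCharacter ℂ q)).card := card_erase_le
      _ = Fintype.card (DirichletCharacter ℂ q) := card_univ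
      _ = Nat.card (DirichletCharacter ℂ q) := Nat.card_eq_fintype_card.symm
      _ = q.totient := DirichletCharacter.card_eq_totient_of_hasEnoughRootsOfUnity ℂ q
  have hE0 : 0 ≤ Real.log q + 2 * Real.sqrt N * Real.log N := by
    have h1 : 0 ≤ Real.log q := Real.log_natCast_nonneg q
    have h2 : 0 ≤ Real.log N := Real.log_natCast_nonneg N
    positivity
  calc ∑ χ ∈ (univ : Finset (DirichletCharacter ℂ q)).erase 1, ‖charPsi χ N‖
      ≤ ∑ χ ∈ (univ : Finset (DirichletCharacter ℂ q)).erase 1,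
          (‖gallagherTerm χ.primitiveCharacter N N‖ + (Real.log q + 2 * Real.sqrt N * Real.log N)) := by
        refine sum_le_sum fun χ hχ => ?_
        have := norm_charPsi_le_gallagherTerm χ (ne_of_mem_erase hχ) hN
        linarith
    _ = ∑ χ ∈ (univ : Finset (DirichletCharacter ℂ q)).erase 1, ‖gallagherTerm χ.primitiveCharacter N N‖ +
          (((univ : Finset (DirichletCharacter ℂ q)).erase 1).card : ℝ) *
            (Real.log q + 2 * Real.sqrt N * Real.log N) := by
        rw [sum_add_distrib, sum_const, nsmul_eq_mul]
    _ ≤ ∑ χ : DirichletCharacter ℂ q, ‖gallagherTerm χ.primitiveCharacter N N‖ +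
          (q.totient : ℝ) * (Real.log q + 2 * Real.sqrt N * Real.log N) := by
        refine add_le_add ?_ ?_
        · exact sum_le_sum_of_subset_of_nonneg (erase_subset _ _) fun _ _ _ => norm_nonneg _
        · exact mul_le_mul_of_nonneg_right (by exact_mod_cast hcard) hE0

/-- Parseval with an `ℓ¹ → ℓ²` step on the non-principal characters:
`Σ_χ ‖ψ(N,χ)‖² ≤ ψ(N)² + (Σ_{χ ≠ χ₀} ‖ψ(N,χ)‖)²`. -/
theorem sum_norm_sq_charPsi_le_sq_sum {q : ℕ} [NeZero q] (N : ℕ) :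
    ∑ χ : DirichletCharacter ℂ q, ‖charPsi χ N‖ ^ 2 ≤
      Chebyshev.psi N ^ 2 + (∑ χ ∈ (univ : Finset (DirichletCharacter ℂ q)).erase 1, ‖charPsi χ N‖) ^ 2 := by
  classical
  rw [← Finset.add_sum_erase _ _ (mem_univ (1 : DirichletCharacter ℂ q))]
  refine add_le_add ?_ ?_
  · have h1 : ‖charPsi (1 : DirichletCharacter ℂ q) N‖ ≤ Chebyshev.psi N := by
      rw [CharacterNecessity.charPsi_one, Complex.norm_real, Real.norm_of_nonneg
        (sum_nonneg fun _ _ => ArithmeticFunction.vonMangoldt_nonneg), psi_eq_sum_Icc]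
      exact sum_le_sum_of_subset_of_nonneg (filter_subset _ _)
        fun _ _ _ => ArithmeticFunction.vonMangoldt_nonneg
    exact pow_le_pow_left₀ (norm_nonneg _) h1 2
  · exact sum_sq_le_sq_sum_of_nonneg fun _ _ => norm_nonneg _

/-! ### The stub -/

/-- The level `θ₁(ε)`: given `c, K > 0`, a target `0 < t` and a cap `θ₀ > 0` there is `0 < θ₁ ≤ θ₀` with
`K e^{−c/θ₁} ≤ K t`, i.e. `e^{−c/θ₁} ≤ t`. -/
theorem exists_level_exp_le {c θ₀ t : ℝ} (hc : 0 < c) (hθ₀ : 0 < θ₀) (ht : 0 < t) :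
    ∃ θ₁ : ℝ, 0 < θ₁ ∧ θ₁ ≤ θ₀ ∧ Real.exp (-c / θ₁) ≤ t := by
  refine ⟨min θ₀ (c / max 1 (Real.log (1 / t))), lt_min hθ₀ (by positivity), min_le_left _ _, ?_⟩
  set θ₁ := min θ₀ (c / max 1 (Real.log (1 / t))) with hθ₁
  have hθ₁0 : 0 < θ₁ := lt_min hθ₀ (by positivity)
  have hM : 1 ≤ max 1 (Real.log (1 / t)) := le_max_left _ _
  have hM0 : 0 < max 1 (Real.log (1 / t)) := by linarith
  -- `log(1/t) ≤ max 1 (log(1/t)) ≤ c/θ₁`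
  have h1 : max 1 (Real.log (1 / t)) ≤ c / θ₁ := by
    rw [le_div_iff₀ hθ₁0]
    have h2 : θ₁ ≤ c / max 1 (Real.log (1 / t)) := min_le_right _ _
    rw [le_div_iff₀ hM0] at h2
    linarith
  have h2 : Real.log (1 / t) ≤ c / θ₁ := (le_max_right _ _).trans h1
  calc Real.exp (-c / θ₁) = Real.exp (-(c / θ₁)) := by rw [neg_div]
    _ ≤ Real.exp (-Real.log (1 / t)) := Real.exp_le_exp.2 (by linarith)
    _ = t := by rw [Real.log_div (by norm_num) ht.ne', Real.log_one, zero_sub, neg_neg, Real.exp_log ht]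

/-- **`stub_flatSecondMoment` (A)** (registered stub of the line `floating-level-core`, crux stmt-Parity-14113): the
no-Siegel-zero region rh.S34 implies the class second moment `Σ_{a mod q} ψ(N;q,a)² ≤ (1+ε)(N²/φ(q) + N log N)` for
`q ≤ N^{θ₁(ε)}`, `N ≥ N₀(ε)` — Linnik's range, the level floating with the accuracy. Gallagher's prime number
theorem (`linnikCharSum_of_noSiegelZeros`: DH-free log-free Gallagher bound with adjustable threshold, its
exceptional clause void under rh.S34) + Parseval on `(ℤ/qℤ)ˣ`. [cite: Gallagher1970, Theorem 7] -/
theorem stub_flatSecondMoment :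
    Literature.NumberTheory.LFunctions.NoSiegelZeros → LowClassSecondMomentFlat := by
  intro hS ε hε
  obtain ⟨c, hc, θ₀, hθ₀, K, hK, hLin⟩ := linnikCharSum_of_noSiegelZeros hS
  -- accuracy `ε' = min ε 1`
  set ε' := min ε 1 with hε'
  have hε'0 : 0 < ε' := lt_min hε one_pos
  have hε'1 : ε' ≤ 1 := min_le_right _ _
  have hε'ε : ε' ≤ ε := min_le_left _ _
  have hsq : 0 < Real.sqrt ε' := Real.sqrt_pos.2 hε'0
  have hsq2 : Real.sqrt ε' ^ 2 = ε' := Real.sq_sqrt hε'0.le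
  -- the level: `θ₁ ≤ min θ₀ (1/4)` with `K e^{−c/θ₁} ≤ √ε'/4`
  obtain ⟨θ₁, hθ₁, hθ₁le, hexp⟩ := exists_level_exp_le hc (lt_min hθ₀ (by norm_num : (0 : ℝ) < 1 / 4))
    (show 0 < Real.sqrt ε' / (4 * K) by positivity)
  have hθ₁θ₀ : θ₁ ≤ θ₀ := hθ₁le.trans (min_le_left _ _)
  have hθ₁4 : θ₁ ≤ 1 / 4 := hθ₁le.trans (min_le_right _ _)
  have hKexp : K * Real.exp (-c / θ₁) ≤ Real.sqrt ε' / 4 := by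
    calc K * Real.exp (-c / θ₁) ≤ K * (Real.sqrt ε' / (4 * K)) := mul_le_mul_of_nonneg_left hexp hK.le
      _ = Real.sqrt ε' / 4 := by field_simp
  obtain ⟨N₁, hN₁⟩ := hLin θ₁ hθ₁ hθ₁θ₀
  -- thresholds (all at the FIXED exponents `3/4`, `1/4`; chosen after `θ₁`, i.e. after `ε`)
  have hδ : (0 : ℝ) < ε' / 5 := by positivity
  obtain ⟨N₀, hN₀⟩ := Filter.eventually_atTop.1 ((eventually_psi_le hδ).and
    (((eventually_rpow_mul_log_pow_le (show (3 / 4 : ℝ) < 1 by norm_num) 1 (show (0 : ℝ) ≤ 3 by norm_num)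
        (show 0 < Real.sqrt ε' / 4 by positivity)).and
      (eventually_rpow_mul_log_pow_le (show (1 / 4 : ℝ) < 1 by norm_num) 2 (show (0 : ℝ) ≤ 9 by norm_num)
        (show 0 < ε' / 4 by positivity))).and
        (eventually_ge_atTop (max N₁ 2))))
  refine ⟨θ₁, hθ₁, N₀, fun N hN q hq hqθ => ?_⟩
  obtain ⟨hpsi, ⟨hE2, hE3⟩, hNmax⟩ := hN₀ N hN
  have hNN₁ : N₁ ≤ N := le_of_max_le_left hNmax
  have hN2 : 2 ≤ N := le_of_max_le_right hNmax
  haveI : NeZero q := ⟨by omega⟩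
  have hN1 : 1 ≤ N := by omega
  have hNr : (1 : ℝ) ≤ N := by exact_mod_cast hN1
  have hNpos : (0 : ℝ) < N := by positivity
  -- `q ≤ N^{θ₁} ≤ N^{1/4} ≤ N`
  have hθ14 : (N : ℝ) ^ θ₁ ≤ (N : ℝ) ^ (1 / 4 : ℝ) := Real.rpow_le_rpow_of_exponent_le hNr hθ₁4
  have hqN : q ≤ N := by
    have : (q : ℝ) ≤ N := hqθ.trans (by
      calc (N : ℝ) ^ θ₁ ≤ (N : ℝ) ^ (1 : ℝ) := Real.rpow_le_rpow_of_exponent_le hNr (by linarith)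
        _ = N := Real.rpow_one _)
    exact_mod_cast this
  have hφpos : (0 : ℝ) < q.totient := by exact_mod_cast Nat.totient_pos.2 (by omega)
  have hφq : (q.totient : ℝ) ≤ q := by exact_mod_cast Nat.totient_le q
  have hφ4 : (q.totient : ℝ) ≤ (N : ℝ) ^ (1 / 4 : ℝ) := hφq.trans (hqθ.trans hθ14)
  have h40 : 0 ≤ (N : ℝ) ^ (1 / 4 : ℝ) := Real.rpow_nonneg hNpos.le _
  -- the ℓ¹ bound on the non-principal characters: `T ≤ (√ε'/2) N`
  set T := ∑ χ ∈ (univ : Finset (DirichletCharacter ℂ q)).erase 1, ‖charPsi χ N‖ with hTdef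
  have hT0 : 0 ≤ T := sum_nonneg fun _ _ => norm_nonneg _
  have hlogN : 0 ≤ Real.log N := Real.log_nonneg hNr
  have hsqN : 1 ≤ Real.sqrt N := by
    rw [show (1 : ℝ) = Real.sqrt 1 from Real.sqrt_one.symm]
    exact Real.sqrt_le_sqrt hNr
  have hjunk : Real.log q + 2 * Real.sqrt N * Real.log N ≤ 3 * Real.sqrt N * Real.log N := by
    have hq0 : (0 : ℝ) < q := by exact_mod_cast (show 0 < q by omega)
    have h1 : Real.log q ≤ Real.log N := Real.log_le_log hq0 (by exact_mod_cast hqN)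
    have h2 : Real.log N ≤ Real.sqrt N * Real.log N := le_mul_of_one_le_left hlogN hsqN
    linarith
  have h34 : (N : ℝ) ^ (1 / 4 : ℝ) * Real.sqrt N = (N : ℝ) ^ (3 / 4 : ℝ) := by
    rw [Real.sqrt_eq_rpow, ← Real.rpow_add hNpos]
    norm_num
  have hT : T ≤ Real.sqrt ε' / 2 * N := by
    have h1 : T ≤ K * Real.exp (-c / θ₁) * N +
        (q.totient : ℝ) * (Real.log q + 2 * Real.sqrt N * Real.log N) := by
      have ha := sum_norm_charPsi_le (q := q) hN1
      have hb := hN₁ N hNN₁ q hqθ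
      linarith
    have h2 : K * Real.exp (-c / θ₁) * N ≤ Real.sqrt ε' / 4 * N := mul_le_mul_of_nonneg_right hKexp hNpos.le
    have h3 : (q.totient : ℝ) * (Real.log q + 2 * Real.sqrt N * Real.log N) ≤ Real.sqrt ε' / 4 * N := by
      calc (q.totient : ℝ) * (Real.log q + 2 * Real.sqrt N * Real.log N)
          ≤ (N : ℝ) ^ (1 / 4 : ℝ) * (3 * Real.sqrt N * Real.log N) :=
            mul_le_mul hφ4 hjunk (by positivity) h40
        _ = 3 * (N : ℝ) ^ (3 / 4 : ℝ) * Real.log N ^ 1 := by rw [← h34]; ring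
        _ ≤ Real.sqrt ε' / 4 * N := hE2
    linarith
  have hT2 : T ^ 2 ≤ ε' / 4 * (N : ℝ) ^ 2 := by
    calc T ^ 2 ≤ (Real.sqrt ε' / 2 * N) ^ 2 := pow_le_pow_left₀ hT0 hT 2
      _ = Real.sqrt ε' ^ 2 / 4 * (N : ℝ) ^ 2 := by ring
      _ = ε' / 4 * (N : ℝ) ^ 2 := by rw [hsq2]
  -- coprime classes (Parseval)
  have hcop : (q.totient : ℝ) * ∑ a ∈ (range q).filter (fun a => a.Coprime q), classPsi N q a ^ 2 ≤
      Chebyshev.psi N ^ 2 + T ^ 2 := by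
    rw [totient_mul_sum_coprime_sq]
    exact sum_norm_sq_charPsi_le_sq_sum N
  -- non-coprime classes
  have hnc : ∑ a ∈ (range q).filter (fun a => ¬ a.Coprime q), classPsi N q a ^ 2 ≤ 9 * N * Real.log N ^ 2 :=
    sum_not_coprime_sq_le hN1 hqN
  -- assemble `φ(q) · Σ_a ψ(N;q,a)² ≤ (1 + ε') N²`
  have hsplit := sum_filter_add_sum_filter_not (range q) (fun a => a.Coprime q) (fun a => classPsi N q a ^ 2)
  have hψ0 : 0 ≤ Chebyshev.psi N := Chebyshev.psi_nonneg _
  have hψ2 : Chebyshev.psi N ^ 2 ≤ (1 + ε' / 2) * (N : ℝ) ^ 2 := by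
    have h1 : Chebyshev.psi N ^ 2 ≤ ((1 + ε' / 5) * N) ^ 2 := pow_le_pow_left₀ hψ0 hpsi 2
    have h2 : (1 + ε' / 5) ^ 2 ≤ 1 + ε' / 2 := by nlinarith
    calc Chebyshev.psi N ^ 2 ≤ ((1 + ε' / 5) * N) ^ 2 := h1
      _ = (1 + ε' / 5) ^ 2 * (N : ℝ) ^ 2 := by ring
      _ ≤ (1 + ε' / 2) * (N : ℝ) ^ 2 := mul_le_mul_of_nonneg_right h2 (sq_nonneg _)
  have hnc2 : (q.totient : ℝ) * (9 * N * Real.log N ^ 2) ≤ ε' / 4 * (N : ℝ) ^ 2 := by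
    calc (q.totient : ℝ) * (9 * N * Real.log N ^ 2) ≤ (N : ℝ) ^ (1 / 4 : ℝ) * (9 * N * Real.log N ^ 2) := by
          gcongr
      _ = (9 * (N : ℝ) ^ (1 / 4 : ℝ) * Real.log N ^ 2) * N := by ring
      _ ≤ (ε' / 4 * N) * N := mul_le_mul_of_nonneg_right hE3 hNpos.le
      _ = ε' / 4 * (N : ℝ) ^ 2 := by ring
  have htot : (q.totient : ℝ) * ∑ a ∈ range q, classPsi N q a ^ 2 ≤ (1 + ε') * (N : ℝ) ^ 2 := by
    rw [← hsplit, mul_add]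
    have hnc' : (q.totient : ℝ) * ∑ a ∈ (range q).filter (fun a => ¬ a.Coprime q), classPsi N q a ^ 2 ≤
        ε' / 4 * (N : ℝ) ^ 2 := (mul_le_mul_of_nonneg_left hnc hφpos.le).trans hnc2
    linarith
  -- divide by `φ(q)` and add the (unused) `N log N` slack
  have hNlog : 0 ≤ (N : ℝ) * Real.log N := mul_nonneg hNpos.le hlogN
  have hdiv : ∑ a ∈ range q, classPsi N q a ^ 2 ≤ (1 + ε') * ((N : ℝ) ^ 2 / q.totient) := by
    rw [mul_div_assoc', le_div_iff₀ hφpos, mul_comm]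
    exact htot
  calc ∑ a ∈ range q, classPsi N q a ^ 2 ≤ (1 + ε') * ((N : ℝ) ^ 2 / q.totient) := hdiv
    _ ≤ (1 + ε) * ((N : ℝ) ^ 2 / q.totient) := by
        gcongr
    _ ≤ (1 + ε) * ((N : ℝ) ^ 2 / q.totient + N * Real.log N) := by
        have : 0 ≤ 1 + ε := by linarith
        gcongr
        linarith

end Summit.Parity.GeneralizedHardyLittlewood.Cruxes.RelativeDimOne.FloatingLevelCore

end
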